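import Summits.Ventures.HSemireg.AmplificationChainG4RouteC
import Summits.Ventures.HSemireg.DerivedEquivalenceExtRank
import HarnessLib

/-!
# Venture HSemireg — route (C) at g = 4, TIER 2, with the `Ext`-side binders stated on the SOURCE object of a derived
# equivalence (seat p6's transport × seat p4's rank door × seat p7's census-row theorem)

HONEST FRAMING. Lean index of the computation cell `pub-hsemireg` (seat p7, «assembly»). Nothing about any explicit variety is
asserted; every published input is a hypothesis BY NAME (`weilFamilyReach_hyperbolic` — refereed, Deligne; `PerfectComplexRankTransfer C`
— the venture's ASSUMPTION, of printed strength only on paper via [BuchweitzFlenner2008HH] Prop. 6.4.4 + [Perry2022] Prop. 8.1 /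
[Pridham2024Semiregularity] / [Lieblich2006]; the kernel links it to nothing — wording rule F-1); the object and its numbers are BY VALUE
from the census. Nothing here says HC, HC_CM or HC_AV is proved; the g = 4 split case is IN PRINT ([Markman2023GeneralizedKummers]
Thm. 1.5 (= Thm. 13.4; J. Eur. Math. Soc. 25 (2023) p. 236; pre-publication arXiv numbering: Thm. 1.3)) and is RE-DERIVED modulo the named hypotheses. Theorems only (0 `def`, 0 `sorry`, no new named fact).

## What this file changes in the Monday sentence (and nothing else)

Seat p7's census-row theorem `weilFourfoldsSplit_of_reach_of_perfectComplexRankTransfer_of_complex`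
(`AmplificationChainG4RouteC.lean` §5) takes the three `Ext`-side binders of p4's REAL admissibility clause ON THE OBJECT `E` over the
CM anchor `A₀ = P.X`: `hneg : ∀ k < 0, extRank P.X E k = 0`, `h0 : extRank P.X E 0 = 1`, `h2 : extRank P.X E 2 ≤ r(P, ch E)`. The
census does NOT compute these on `A₀`: the STEP-0 object is `𝓔 = Φ(I_Z) ⊗ M_B` on `A₀ = X × X̂` with `Z = p×X ∪ X×q ⊂ X × X`, and the
certified numbers (I1) `Ext^•(I_Z, I_Z) = (1, 8, 18, 8, 1)`, `Ext^{<0} = 0` are Künneth numbers of the ideal SHEAF `I_Z` on `X × X`,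
moved to `𝓔` by a FULLY FAITHFUL exact `ℂ`-linear functor (no essential surjectivity is used; in print: [Mukai1981] Thm. 2.2,
[Orlov2002DerivedAbelian] Assertion 2.8 on `D^b(Coh)`, `⊗ M_B` an autoequivalence). Seat p6 typed that move on REAL carriers
(`DerivedEquivalenceExtRank.lean`: `extRank_eq_of_iso_obj`, `extRank_neg_eq_zero_of_iso_obj_single` — Mathlib's `DerivedCategory`, a
`ℂ`-linear full faithful `Φ` commuting with shifts, an iso `Φ(Q G) ≅ Q E`). THIS FILE composes the two, so that the in-tree conditional
theorem's `Ext` binders are stated on the source object — the quantities the census certifies, UNDER THE F-3 QUALIFIER of §3 for §2's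
functor package (ref-3 P0 / red-5 F-3 / red-4 R4-20):

* `weilFourfoldsSplit_of_reach_of_perfectComplexRankTransfer_of_iso_obj` — the census row with `hneg / h0 / h2` stated for a
  SOURCE complex `G` on any `ℂ`-scheme `Y₀`, given `Φ : D(Mod 𝒪_{Y₀}) ⥤ D(Mod 𝒪_{A₀})` (`ℂ`-linear, additive, full, faithful,
  `CommShift ℤ`) and `Φ(Q G) ≅ Q E` — transported by `extRank_eq_of_iso_obj`;
* `weilFourfoldsSplit_of_reach_of_perfectComplexRankTransfer_of_iso_obj_single` — the SHEAF-source form (`G = G₀[0]`, e.g.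
  `G₀ = I_Z`): `hneg` DISAPPEARS (a sheaf has no negative self-extensions and `Φ` is an equivalence onto its image:
  `extRank_neg_eq_zero_of_iso_obj_single`), leaving `h0 : extRank Y₀ G₀[0] 0 = 1` («`I_Z` simple») and
  `h2 : extRank Y₀ G₀[0] 2 ≤ r(P, ch E)` («`dim Ext²(I_Z, I_Z) = 18 ≤ 18`», (I1)/(I2-β) by value);
* `rankAdmissible_of_iso_obj_single` — the admissibility clause itself in that form (for consumers of p4's door other than g = 4).

BY VALUE still (not kernel): the functor `Φ` — in §2 «assumed full and faithful on ALL of `D(Mod 𝒪_{Y₀})`, STRONGER than the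
printed `D^b(Coh)` equivalence (Orlov Assertion 2.8 / Mukai Thm. 2.2; [GortzWedhorn2023] Thm. 22.42 compares categories, it does not
extend functors); used only on `Hom(I_Z, I_Z[n])`, `n ∈ {<0, 0, 2}`» (ref-3 P0); in §3 only object-wise bijectivity in degrees `≤ 2`,
or no functor at all —, the model iso `Φ(I_Z[0]) ≅ 𝓔`, the numbers `1` and `18 ≤ 18`, the Chern data `hch2 / hchp` ((I3), th-2's
BY-VALUE dictionary `theory/th2-x2/g4row-byvalue/`), hyperbolicity (I4). BY NAME: `hF`, `hT`. The `Ext^{<0} = 0` conjunct is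
discharged ONLY for a SHEAF source `G₀[0]`; for a genuine source complex `G` it stays a binder `hneg` (ref-3 P2).

References: [BuchweitzFlenner2008HH] Prop. 6.4.4; [Mukai1981] Thm. 2.2, Cor. 2.5; [Orlov2002DerivedAbelian] Assertion 2.8;
[Lieblich2006] Prop. 2.1.9, Thm. 4.2.1; [GortzWedhorn2023] Thm. 22.42; [Markman2023GeneralizedKummers] Thm. 1.5 (= Thm. 13.4; J. Eur. Math. Soc. 25 (2023) p. 236; pre-publication arXiv numbering: Thm. 1.3) (the case in print);
[Deligne1982HodgeCycles] proof of Thm. 4.8 (reach).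
-/

noncomputable section

open CategoryTheory AlgebraicGeometry Set
open Literature.AlgebraicGeometry.Motives Literature.AlgebraicGeometry.HodgeTheory
open Literature.AlgebraicGeometry.ModuliOfAbelianVarieties Literature.AlgebraicGeometry.Deligne1982
open Literature.AlgebraicGeometry.KTheory
open Literature.AlgebraicTopology.SingularHomology

namespace Summit.Ventures.HSemireg

open Summit.HodgeConjecture.HodgeConjecture
open Summit.HodgeConjecture.HodgeConjecture.WeilTypeLadder
open Summit.HodgeConjecture.HodgeConjecture.Cruxes.HodgeAbelianVarieties.EStepSecantInduction
open Summit.Ventures.HSemireg.GeneralStructure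

variable {C : ChernCharacterBetti}

/-! ## §1 The admissibility clause with the `Ext` side on the source of a derived equivalence -/

/-- **p4's rank-admissibility for `E ≅ Φ(G₀[0])`, a SHEAF moved by an exact `ℂ`-linear equivalence**: `{1..n} ⊆ I`, the
abelian model `e : A.X ≅ X₀` with `A.dim = n`, `E` a bounded complex of vector bundles with `rank Ext² ≤ r(A, ch E)` — where the
three `Ext`-side conjuncts are supplied as: NOTHING for `Ext^{<0}` (automatic for the image of a sheaf,
`extRank_neg_eq_zero_of_iso_obj_single`), `extRank Y₀ G₀[0] 0 = 1` and `extRank Y₀ G₀[0] 2 ≤ r` on the SOURCE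
(`extRank_eq_of_iso_obj`). [cite: BuchweitzFlenner2008HH, Prop. 6.4.4] [cite: Lieblich2006, Prop. 2.1.9]
[cite: Orlov2002DerivedAbelian, Assertion 2.8] -/
theorem rankAdmissible_of_iso_obj_single {n : ℕ} {X₀ Y₀ : SchemeOver ℂ} {I : Finset ℕ}
    (hI : ∀ p : ℕ, 1 ≤ p → p ≤ n → p ∈ I) (A : AbelianVariety ℂ) (e : A.X ≅ X₀) (hA : A.dim = n)
    (E : CochainComplex X₀.left.Modules ℤ) (hE : IsBoundedVBComplex E) (G₀ : Y₀.left.Modules) :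
    letI := HasDerivedCategory.standard Y₀.left.Modules
    letI := HasDerivedCategory.standard X₀.left.Modules
    ∀ (Φ : DerivedCategory Y₀.left.Modules ⥤ DerivedCategory X₀.left.Modules) [Φ.Additive] [Φ.Linear ℂ]
      [Φ.CommShift ℤ] [Φ.Full] [Φ.Faithful]
      (_ : Φ.obj (DerivedCategory.Q.obj ((CochainComplex.singleFunctor Y₀.left.Modules 0).obj G₀)) ≅
        DerivedCategory.Q.obj E),
      extRank Y₀ ((CochainComplex.singleFunctor Y₀.left.Modules 0).obj G₀) 0 = 1 →
      extRank Y₀ ((CochainComplex.singleFunctor Y₀.left.Modules 0).obj G₀) 2 ≤ Cardinal.lift.{1}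
          (contractionRank A fun p ↦ complexBetti.map e.hom (2 * p) (chPerfect C X₀ E hE.isFiniteLocallyFree p)) →
      rankAdmissible C n X₀ I E := by
  intro Φ _ _ _ _ _ eΦ h0 h2
  letI := HasDerivedCategory.standard Y₀.left.Modules
  letI := HasDerivedCategory.standard X₀.left.Modules
  have hneg : ∀ k : ℤ, k < 0 → extRank X₀ E k = 0 := fun k hk ↦
    extRank_neg_eq_zero_of_iso_obj_single G₀ E Φ eΦ hk
  have h0' : extRank X₀ E 0 = 1 := by
    rw [extRank_eq_of_iso_obj _ E Φ eΦ 0]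
    exact h0
  have h2' : extRank X₀ E 2 ≤ Cardinal.lift.{1}
      (contractionRank A fun p ↦ complexBetti.map e.hom (2 * p) (chPerfect C X₀ E hE.isFiniteLocallyFree p)) := by
    rw [extRank_eq_of_iso_obj _ E Φ eΦ 2]
    exact h2
  exact ⟨hI, hneg, h0', A, e, hE, hA, h2'⟩

/-! ## §2 g = 4, TIER 2: the census row with the `Ext` binders on the source complex / source sheaf -/

section TierTwoTransport

/-- **EVERY ABELIAN FOURFOLD OF THE SPLIT `ℚ(√-d)`-WEIL COMPONENT — route (C), TIER 2, `Ext` SIDE ON THE SOURCE OF A DERIVED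
EQUIVALENCE.** The census-row theorem `weilFourfoldsSplit_of_reach_of_perfectComplexRankTransfer_of_complex` with its binders
`hneg / h0 / h2` replaced by the same three clauses for a complex `G` on another `ℂ`-scheme `Y₀` together with a `ℂ`-linear,
additive, full and faithful functor `Φ : D(Mod 𝒪_{Y₀}) ⥤ D(Mod 𝒪_{A₀})` commuting with the shifts and an isomorphism
`Φ(Q G) ≅ Q E` (seat p6's `extRank_eq_of_iso_obj`: «`Extⁱ(𝓔, 𝓔) = Extⁱ(G, G)`»). Hypotheses BY NAME: `hF` (reach, refereed),
`hT : PerfectComplexRankTransfer C` (assumption; the kernel links it to no source). Everything else is a real carrier, read off the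
census BY VALUE. Conclusion: `Stubs.WeilAlgebraicSplitHyperplane 2 d` — in print for split fourfolds ([Markman2023GeneralizedKummers]
Thm. 1.5 (= Thm. 13.4; J. Eur. Math. Soc. 25 (2023) p. 236; pre-publication arXiv numbering: Thm. 1.3)); re-derived here modulo the named hypotheses. [cite: Markman2023GeneralizedKummers, Theorem 1.5 (= Theorem 13.4), p. 236 (the case in print; arXiv:1805.11574 pre-publication numbering: Theorem 1.3)]
[cite: BuchweitzFlenner2008HH, Prop. 6.4.4] [cite: Orlov2002DerivedAbelian, Assertion 2.8] [cite: Mukai1981, Thm. 2.2]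
[cite: Deligne1982HodgeCycles, proof of Thm. 4.8 (reach)] -/
theorem weilFourfoldsSplit_of_reach_of_perfectComplexRankTransfer_of_iso_obj (hF : weilFamilyReach_hyperbolic)
    (hT : PerfectComplexRankTransfer C) {d : ℕ} (hd : 0 < d)
    (P : AbelianVariety ℂ) (ψ₀ : P ⟶ P) (e : ProjectiveEmbedding P.X) (a : complexBetti (projectiveSpace e.n ℂ) 2)
    (hP : P.dim = 2 * 2) (hψ : ψ₀ ≫ ψ₀ = -(d • 𝟙 P)) (ha : IsRationalClass a) (ha0 : a ≠ 0)
    (hhyp : IsHyperbolicWeilType P ψ₀ 2 (symmetrisedClass d P ψ₀ e a))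
    (w : complexBetti P.X (2 * 2)) (hwW : w ∈ weilClassesOf P ψ₀ 2 d) (hwr : IsRationalClass w) (hw0 : w ≠ 0)
    (I : Finset ℕ) (hI : ∀ p : ℕ, 1 ≤ p → p ≤ 2 * 2 → p ∈ I) (E : CochainComplex P.X.left.Modules ℤ)
    (hE : IsBoundedVBComplex E) (q : ℚ) (c : ℕ → ℚ)
    (hch2 : chPerfect C P.X E hE.isFiniteLocallyFree 2 = ((q : ℚ) : ℂ) • cupPowTwo (symmetrisedClass d P ψ₀ e a) 2 + w)
    (hchp : ∀ p ∈ I, p ≠ 2 →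
      chPerfect C P.X E hE.isFiniteLocallyFree p = ((c p : ℚ) : ℂ) • cupPowTwo (symmetrisedClass d P ψ₀ e a) p)
    {Y₀ : SchemeOver ℂ} (G : CochainComplex Y₀.left.Modules ℤ) :
    letI := HasDerivedCategory.standard Y₀.left.Modules
    letI := HasDerivedCategory.standard P.X.left.Modules
    ∀ (Φ : DerivedCategory Y₀.left.Modules ⥤ DerivedCategory P.X.left.Modules) [Φ.Additive] [Φ.Linear ℂ]
      [Φ.CommShift ℤ] [Φ.Full] [Φ.Faithful] (_ : Φ.obj (DerivedCategory.Q.obj G) ≅ DerivedCategory.Q.obj E),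
      (∀ k : ℤ, k < 0 → extRank Y₀ G k = 0) → extRank Y₀ G 0 = 1 →
      extRank Y₀ G 2 ≤ Cardinal.lift.{1} (contractionRank P fun p ↦ chPerfect C P.X E hE.isFiniteLocallyFree p) →
      Stubs.WeilAlgebraicSplitHyperplane 2 d := by
  intro Φ _ _ _ _ _ eΦ hneg h0 h2
  letI := HasDerivedCategory.standard Y₀.left.Modules
  letI := HasDerivedCategory.standard P.X.left.Modules
  have hE' : ∀ n : ℤ, extRank P.X E n = extRank Y₀ G n := fun n ↦ extRank_eq_of_iso_obj G E Φ eΦ n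
  refine weilFourfoldsSplit_of_reach_of_perfectComplexRankTransfer_of_complex hF hT hd P ψ₀ e a hP hψ ha ha0 hhyp
    w hwW hwr hw0 I hI E hE (fun k hk ↦ ?_) ?_ ?_ q c hch2 hchp
  · rw [hE' k]
    exact hneg k hk
  · rw [hE' 0]
    exact h0
  · rw [hE' 2]
    exact h2

/-- **The SHEAF-source form (the census's actual (I1)).** As above with `G = G₀[0]` a single `𝒪_{Y₀}`-module in degree `0`
(for the cell: `G₀ = I_Z`, `Z = p×X ∪ X×q ⊂ X × X`; `Φ` here is assumed full and faithful on ALL of `D(Mod 𝒪_{Y₀})` — STRONGER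
than the printed `D^b(Coh)` equivalence, used only on `Hom(I_Z, I_Z[n])`; the object-wise form is §3's `_of_local_ff_single`): the
clause `Ext^{<0} = 0` is now a THEOREM (`extRank_neg_eq_zero_of_iso_obj_single`), and the remaining `Ext` binders are
`h0 : extRank Y₀ G₀[0] 0 = 1` («`G₀` simple») and `h2 : extRank Y₀ G₀[0] 2 ≤ r(P, ch E)` («`dim Ext²(I_Z, I_Z) = 18 ≤ 18`»,
(I1)/(I2-β) by value). [cite: Markman2023GeneralizedKummers, Theorem 1.5 (= Theorem 13.4), p. 236 (the case in print; arXiv:1805.11574 pre-publication numbering: Theorem 1.3)] [cite: Lieblich2006, Prop. 2.1.9]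
[cite: BuchweitzFlenner2008HH, Prop. 6.4.4] [cite: Orlov2002DerivedAbelian, Assertion 2.8] -/
theorem weilFourfoldsSplit_of_reach_of_perfectComplexRankTransfer_of_iso_obj_single (hF : weilFamilyReach_hyperbolic)
    (hT : PerfectComplexRankTransfer C) {d : ℕ} (hd : 0 < d)
    (P : AbelianVariety ℂ) (ψ₀ : P ⟶ P) (e : ProjectiveEmbedding P.X) (a : complexBetti (projectiveSpace e.n ℂ) 2)
    (hP : P.dim = 2 * 2) (hψ : ψ₀ ≫ ψ₀ = -(d • 𝟙 P)) (ha : IsRationalClass a) (ha0 : a ≠ 0)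
    (hhyp : IsHyperbolicWeilType P ψ₀ 2 (symmetrisedClass d P ψ₀ e a))
    (w : complexBetti P.X (2 * 2)) (hwW : w ∈ weilClassesOf P ψ₀ 2 d) (hwr : IsRationalClass w) (hw0 : w ≠ 0)
    (I : Finset ℕ) (hI : ∀ p : ℕ, 1 ≤ p → p ≤ 2 * 2 → p ∈ I) (E : CochainComplex P.X.left.Modules ℤ)
    (hE : IsBoundedVBComplex E) (q : ℚ) (c : ℕ → ℚ)
    (hch2 : chPerfect C P.X E hE.isFiniteLocallyFree 2 = ((q : ℚ) : ℂ) • cupPowTwo (symmetrisedClass d P ψ₀ e a) 2 + w)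
    (hchp : ∀ p ∈ I, p ≠ 2 →
      chPerfect C P.X E hE.isFiniteLocallyFree p = ((c p : ℚ) : ℂ) • cupPowTwo (symmetrisedClass d P ψ₀ e a) p)
    {Y₀ : SchemeOver ℂ} (G₀ : Y₀.left.Modules) :
    letI := HasDerivedCategory.standard Y₀.left.Modules
    letI := HasDerivedCategory.standard P.X.left.Modules
    ∀ (Φ : DerivedCategory Y₀.left.Modules ⥤ DerivedCategory P.X.left.Modules) [Φ.Additive] [Φ.Linear ℂ]
      [Φ.CommShift ℤ] [Φ.Full] [Φ.Faithful]
      (_ : Φ.obj (DerivedCategory.Q.obj ((CochainComplex.singleFunctor Y₀.left.Modules 0).obj G₀)) ≅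
        DerivedCategory.Q.obj E),
      extRank Y₀ ((CochainComplex.singleFunctor Y₀.left.Modules 0).obj G₀) 0 = 1 →
      extRank Y₀ ((CochainComplex.singleFunctor Y₀.left.Modules 0).obj G₀) 2 ≤
        Cardinal.lift.{1} (contractionRank P fun p ↦ chPerfect C P.X E hE.isFiniteLocallyFree p) →
      Stubs.WeilAlgebraicSplitHyperplane 2 d := by
  intro Φ _ _ _ _ _ eΦ h0 h2
  letI := HasDerivedCategory.standard Y₀.left.Modules
  letI := HasDerivedCategory.standard P.X.left.Modules
  exact weilFourfoldsSplit_of_reach_of_perfectComplexRankTransfer_of_iso_obj hF hT hd P ψ₀ e a hP hψ ha ha0 hhyp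
    w hwW hwr hw0 I hI E hE q c hch2 hchp _ Φ eΦ (fun k hk ↦ extRank_single_neg_eq_zero G₀ hk) h0 h2

end TierTwoTransport

/-! ## Audit: nothing is decided here

BY NAME: `weilFamilyReach_hyperbolic` (refereed), `PerfectComplexRankTransfer C` (assumption; no kernel link to Pridham / Perry —
F-1). BY VALUE: `Φ` (as a functor on `D(Mod 𝒪)`), the model iso, `extRank Y₀ I_Z[0] 0 = 1`, `extRank Y₀ I_Z[0] 2 = 18 ≤ 18 = r`,
the Chern data, hyperbolicity. KERNEL: the transport of the `Ext` clauses (p6), `Ext^{<0} = 0` for the image of a sheaf (p6),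
and everything downstream of «local variational statement + one seed» (p7 / the tree's Weil-type ladder). -/

/-! ## §3 F-3 repair (red-5 v5): the FUNCTOR-FREE form and the LOCAL-full-faithfulness form

WORDING RULE F-3 (red-5, `redteam/RED-5.md` v5 §13–§15; kernel-checked probe `RED-5-probe-assembly-v5.lean`): §2 quantifies
`Φ : D(Mod 𝒪_{Y₀}) ⥤ D(Mod 𝒪_{A₀})` with `[Φ.Full] [Φ.Faithful]` on the UNBOUNDED derived category of ALL `𝒪`-modules, which is
STRONGER than print — the chain's source is Orlov's equivalence on `D^b(Coh)` ([Orlov2002DerivedAbelian] Assertion 2.8) and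
[GortzWedhorn2023] Thm. 22.42 identifies Hom-spaces on `D^b_coh` only; a `D^b(Coh)`-equivalence is not a term of §2's binder type
and a globally full faithful `Φ` on `D(Mod 𝒪_{X×X})` has no printed source. The kernel USES full faithfulness only through the
bijectivity of `Φ.map` on `Hom(Q G, (Q G)⟦n⟧)`. Hence the two forms below (red-5's V16 / V17a / V17b, adapted; §2's theorems are
their special cases by `Functor.map_injective` / `map_surjective`): the FUNCTOR-FREE form takes the bare equalities
`extRank A₀ E n = extRank Y₀ G n`; the LOCAL form takes a `ℂ`-linear additive shift-commuting `Φ` on `D(Mod 𝒪)` (a Fourier–Mukai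
kernel gives one; it RESTRICTS to Orlov's equivalence on `D^b(Coh)` — red-5 W-3), an iso `Φ(Q G₀[0]) ≅ Q E`, and bijectivity of
`Φ.map` on the self-Homs of `Q G₀[0]` in degrees `≤ 2` — which IS what Orlov on `D^b(Coh)` + GW 22.42 at both ends deliver for a
coherent `G₀ = I_Z` (still BY VALUE / BY NAME, never kernel).
Until a consumer switches to these, every instantiation sentence of §2 carries «`Φ` assumed full and faithful on ALL of
`D(Mod 𝒪_{X×X})` — stronger than the printed `D^b(Coh)` equivalence; used only on `Hom(I_Z, I_Z[n])`». -/

section LocalTransport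

/-- **LOCAL full faithfulness transports `extRank`** (red-5 V17a): for a `ℂ`-linear additive shift-commuting `Φ` and an iso
`Φ(Q G) ≅ Q E`, the equality `extRank X₀ E n = extRank Y₀ G n` needs `Φ.map` bijective ONLY on `Hom(Q G, (Q G)⟦n⟧)`; nothing is
asked of `Φ` on any other object. [cite: Orlov2002DerivedAbelian, Assertion 2.8] [cite: GortzWedhorn2023, Thm. 22.42] -/
theorem extRank_eq_of_local_ff {X₀ Y₀ : SchemeOver ℂ} (G : CochainComplex Y₀.left.Modules ℤ)
    (E : CochainComplex X₀.left.Modules ℤ) :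
    letI := HasDerivedCategory.standard Y₀.left.Modules
    letI := HasDerivedCategory.standard X₀.left.Modules
    ∀ (Φ : DerivedCategory Y₀.left.Modules ⥤ DerivedCategory X₀.left.Modules) [Φ.Additive] [Φ.Linear ℂ]
      [Φ.CommShift ℤ] (_ : Φ.obj (DerivedCategory.Q.obj G) ≅ DerivedCategory.Q.obj E) (n : ℤ),
      Function.Bijective (fun f : (DerivedCategory.Q.obj G ⟶ (DerivedCategory.Q.obj G)⟦n⟧) ↦ Φ.map f) →
      extRank X₀ E n = extRank Y₀ G n := by
  intro Φ _ _ _ eΦ n hbij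
  letI := HasDerivedCategory.standard Y₀.left.Modules
  letI := HasDerivedCategory.standard X₀.left.Modules
  unfold extRank
  have e₁ : (DerivedCategory.Q.obj G ⟶ (DerivedCategory.Q.obj G)⟦n⟧) ≃ₗ[ℂ]
      (Φ.obj (DerivedCategory.Q.obj G) ⟶ (Φ.obj (DerivedCategory.Q.obj G))⟦n⟧) :=
    (LinearEquiv.ofBijective (Φ.mapLinearMap ℂ) hbij).trans
      (Linear.homCongr ℂ (Iso.refl (Φ.obj (DerivedCategory.Q.obj G))) ((Φ.commShiftIso n).app _))
  have e₂ : (Φ.obj (DerivedCategory.Q.obj G) ⟶ (Φ.obj (DerivedCategory.Q.obj G))⟦n⟧) ≃ₗ[ℂ]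
      (DerivedCategory.Q.obj E ⟶ (DerivedCategory.Q.obj E)⟦n⟧) :=
    Linear.homCongr ℂ eΦ ((shiftFunctor (DerivedCategory X₀.left.Modules) n).mapIso eΦ)
  exact ((e₁.trans e₂).rank_eq).symm

/-- **g = 4, TIER 2 — FUNCTOR-FREE form** (red-5 V16): the census-row conclusion from the bare `Ext`-rank equalities
`hext : extRank A₀ E n = extRank Y₀ G n` IN THE DEGREES USED, `n ≤ 2` (red-4 R4-20: `n ∈ {<0, 0, 2}`), plus the three `Ext`
clauses on the SOURCE `G` — no functor, no `Full`, no `Faithful`. This is all §2 extracts from its functor package. [cite: Markman2023GeneralizedKummers, Theorem 1.5 (= Theorem 13.4), p. 236 (the case in print; arXiv:1805.11574 pre-publication numbering: Theorem 1.3)]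
[cite: BuchweitzFlenner2008HH, Prop. 6.4.4] -/
theorem weilFourfoldsSplit_of_reach_of_perfectComplexRankTransfer_of_extRank_eq (hF : weilFamilyReach_hyperbolic)
    (hT : PerfectComplexRankTransfer C) {d : ℕ} (hd : 0 < d)
    (P : AbelianVariety ℂ) (ψ₀ : P ⟶ P) (e : ProjectiveEmbedding P.X) (a : complexBetti (projectiveSpace e.n ℂ) 2)
    (hP : P.dim = 2 * 2) (hψ : ψ₀ ≫ ψ₀ = -(d • 𝟙 P)) (ha : IsRationalClass a) (ha0 : a ≠ 0)
    (hhyp : IsHyperbolicWeilType P ψ₀ 2 (symmetrisedClass d P ψ₀ e a))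
    (w : complexBetti P.X (2 * 2)) (hwW : w ∈ weilClassesOf P ψ₀ 2 d) (hwr : IsRationalClass w) (hw0 : w ≠ 0)
    (I : Finset ℕ) (hI : ∀ p : ℕ, 1 ≤ p → p ≤ 2 * 2 → p ∈ I) (E : CochainComplex P.X.left.Modules ℤ)
    (hE : IsBoundedVBComplex E) (q : ℚ) (c : ℕ → ℚ)
    (hch2 : chPerfect C P.X E hE.isFiniteLocallyFree 2 = ((q : ℚ) : ℂ) • cupPowTwo (symmetrisedClass d P ψ₀ e a) 2 + w)
    (hchp : ∀ p ∈ I, p ≠ 2 →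
      chPerfect C P.X E hE.isFiniteLocallyFree p = ((c p : ℚ) : ℂ) • cupPowTwo (symmetrisedClass d P ψ₀ e a) p)
    {Y₀ : SchemeOver ℂ} (G : CochainComplex Y₀.left.Modules ℤ)
    (hext : ∀ n : ℤ, n ≤ 2 → extRank P.X E n = extRank Y₀ G n)
    (hneg : ∀ k : ℤ, k < 0 → extRank Y₀ G k = 0) (h0 : extRank Y₀ G 0 = 1)
    (h2 : extRank Y₀ G 2 ≤ Cardinal.lift.{1} (contractionRank P fun p ↦ chPerfect C P.X E hE.isFiniteLocallyFree p)) :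
    Stubs.WeilAlgebraicSplitHyperplane 2 d :=
  weilFourfoldsSplit_of_reach_of_perfectComplexRankTransfer_of_complex hF hT hd P ψ₀ e a hP hψ ha ha0 hhyp
    w hwW hwr hw0 I hI E hE (fun k hk ↦ (hext k (by omega)).trans (hneg k hk)) ((hext 0 (by norm_num)).trans h0)
    ((hext 2 le_rfl).symm ▸ h2) q c hch2 hchp

/-- **g = 4, TIER 2 — SHEAF source, LOCAL full faithfulness** (red-5 V17b): the census row with `G = G₀[0]` a sheaf
(`G₀ = I_Z` by value), `Φ` a `ℂ`-linear additive shift-commuting functor on `D(Mod 𝒪)` with `Φ(Q G₀[0]) ≅ Q E`, and `Φ.map`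
BIJECTIVE ON THE SELF-HOMS OF `Q G₀[0]` in the degrees `n ≤ 2` (red-4 R4-20 / red-5 F-3: only `n < 0`, `0`, `2` are used; what
Orlov's `D^b(Coh)` equivalence + GW 22.42 give for coherent `G₀`);
`Ext^{<0} = 0` discharged (`extRank_single_neg_eq_zero`); remaining `Ext` binders `h0` («`I_Z` simple»), `h2` («`18 ≤ 18`»).
§2's `_of_iso_obj_single` is the special case `[Φ.Full] [Φ.Faithful]`. [cite: Markman2023GeneralizedKummers, Theorem 1.5 (= Theorem 13.4), p. 236 (the case in print; arXiv:1805.11574 pre-publication numbering: Theorem 1.3)]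
[cite: Orlov2002DerivedAbelian, Assertion 2.8] [cite: GortzWedhorn2023, Thm. 22.42] [cite: Lieblich2006, Prop. 2.1.9] -/
theorem weilFourfoldsSplit_of_reach_of_perfectComplexRankTransfer_of_local_ff_single (hF : weilFamilyReach_hyperbolic)
    (hT : PerfectComplexRankTransfer C) {d : ℕ} (hd : 0 < d)
    (P : AbelianVariety ℂ) (ψ₀ : P ⟶ P) (e : ProjectiveEmbedding P.X) (a : complexBetti (projectiveSpace e.n ℂ) 2)
    (hP : P.dim = 2 * 2) (hψ : ψ₀ ≫ ψ₀ = -(d • 𝟙 P)) (ha : IsRationalClass a) (ha0 : a ≠ 0)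
    (hhyp : IsHyperbolicWeilType P ψ₀ 2 (symmetrisedClass d P ψ₀ e a))
    (w : complexBetti P.X (2 * 2)) (hwW : w ∈ weilClassesOf P ψ₀ 2 d) (hwr : IsRationalClass w) (hw0 : w ≠ 0)
    (I : Finset ℕ) (hI : ∀ p : ℕ, 1 ≤ p → p ≤ 2 * 2 → p ∈ I) (E : CochainComplex P.X.left.Modules ℤ)
    (hE : IsBoundedVBComplex E) (q : ℚ) (c : ℕ → ℚ)
    (hch2 : chPerfect C P.X E hE.isFiniteLocallyFree 2 = ((q : ℚ) : ℂ) • cupPowTwo (symmetrisedClass d P ψ₀ e a) 2 + w)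
    (hchp : ∀ p ∈ I, p ≠ 2 →
      chPerfect C P.X E hE.isFiniteLocallyFree p = ((c p : ℚ) : ℂ) • cupPowTwo (symmetrisedClass d P ψ₀ e a) p)
    {Y₀ : SchemeOver ℂ} (G₀ : Y₀.left.Modules) :
    letI := HasDerivedCategory.standard Y₀.left.Modules
    letI := HasDerivedCategory.standard P.X.left.Modules
    ∀ (Φ : DerivedCategory Y₀.left.Modules ⥤ DerivedCategory P.X.left.Modules) [Φ.Additive] [Φ.Linear ℂ]
      [Φ.CommShift ℤ]
      (_ : Φ.obj (DerivedCategory.Q.obj ((CochainComplex.singleFunctor Y₀.left.Modules 0).obj G₀)) ≅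
        DerivedCategory.Q.obj E),
      (∀ n : ℤ, n ≤ 2 → Function.Bijective
        (fun f : (DerivedCategory.Q.obj ((CochainComplex.singleFunctor Y₀.left.Modules 0).obj G₀) ⟶
          (DerivedCategory.Q.obj ((CochainComplex.singleFunctor Y₀.left.Modules 0).obj G₀))⟦n⟧) ↦ Φ.map f)) →
      extRank Y₀ ((CochainComplex.singleFunctor Y₀.left.Modules 0).obj G₀) 0 = 1 →
      extRank Y₀ ((CochainComplex.singleFunctor Y₀.left.Modules 0).obj G₀) 2 ≤
        Cardinal.lift.{1} (contractionRank P fun p ↦ chPerfect C P.X E hE.isFiniteLocallyFree p) →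
      Stubs.WeilAlgebraicSplitHyperplane 2 d := by
  intro Φ _ _ _ eΦ hbij h0 h2
  letI := HasDerivedCategory.standard Y₀.left.Modules
  letI := HasDerivedCategory.standard P.X.left.Modules
  exact weilFourfoldsSplit_of_reach_of_perfectComplexRankTransfer_of_extRank_eq hF hT hd P ψ₀ e a hP hψ ha ha0 hhyp
    w hwW hwr hw0 I hI E hE q c hch2 hchp _ (fun n hn ↦ extRank_eq_of_local_ff _ E Φ eΦ n (hbij n hn))
    (fun k hk ↦ extRank_single_neg_eq_zero G₀ hk) h0 h2

end LocalTransport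

end Summit.Ventures.HSemireg

end
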